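import Summits.NavierStokesRegularity.NavierStokesRegularity.Theorems.TerminalTraceTypeITraceScarL3SqrtTwoApexEngine
import Summits.NavierStokesRegularity.NavierStokesRegularity.Theorems.TerminalTraceTypeITraceScarL3SqrtTwoApexReprSliceBounds
import Summits.NavierStokesRegularity.NavierStokesRegularity.Theorems.TerminalTraceTypeITraceScarL3SqrtTwoApexShellPressureMild
import Literature.Analysis.FluidPDE.TypeIRateClassicalRepresentative
import HarnessLib

/-!
# T27-A «THE √2 APEX», UNCONDITIONAL (ROUND-27; item `TerminalTrace.TypeITraceScarL3`,
# stmt-NavierStokesRegularity-18385, Stub LOUD line; helper)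

Seat nsreg-C26-p1 g2 (cell ns-regularity-ideate), `--supports stmt-NavierStokesRegularity-18385` (helper);
planner-of-record nsreg-p2 g29 (ROUND-27 «THE √2 APEX», companion `R27-sqrt2-apex.lean` v2 1e24a2a485d38e8d,
T27-A = `RateSqThreshold` l.128); shell pressure budget in classical form by nsreg-typer g21 (plate b2,
`exists_shellBudget_of_mild`, on nsreg-p7's `sliceFunctional_eq_zero_of_mild`).

* **`two_le_rateSq_of_quietShell`** — T27-A VERBATIM (`RateSqThreshold` spelled out): an extinct Type-I apex of
  class `(M, D₀, C)` — suitable in every `Q(a)` at the origin, weak gradient, `𝐈(Q(a)) ≤ M`, `D ≤ D₀` at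
  apices, rate `‖U(s)‖ ≤ C/√(−s)` a.e., weakly null top — that is BACKWARD SINGULAR at the origin and QUIET on one
  shell slab `]−δ,0[ × {R < |y| < AR}` of ANY ratio `A > 1` has `2 ≤ C²`.
  Proof: the classical Oseen-mild representative below the top (`exists_classical_repr_of_apexPackage`); at
  every late time its window pressures obey the gauge-free shell budget of `exists_shellBudget_of_mild`, whose
  inputs hold at EVERY time by `lintegral_ball_repr_sq_le` (A-Morrey) and `norm_repr_le_of_quietShell` (quiet
  bound); then the engine `two_le_rateSq_of_quietShell_of_reprBudget` (cut-off energy/enstrophy identities,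
  Ghidaglia's sharp inequality `Λ' ≤ ½β²Λ + …`, the transported cubic floor, strong extinction, the frequency
  ODE with the borderline coefficient `C²/(2(−s))`).

WHAT THIS IS NOT: not Stub LOUD (which has no quiet shell), not item 18385, NOT a proof of Navier–Stokes regularity:
a statement about a hypothetical extinct Type-I blow-up profile.  [folklore; Ghidaglia 1986; Temam IDDS 1997
§III.6 L6.1; Kukavica 2007 (5); Seregin2014 Prop. 6.20; CaffarelliKohnNirenberg1982 Thm B;
KochNadirashviliSereginSverak2009 §4; EscauriazaSereginSverak2003 §3]
-/

noncomputable section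

set_option linter.dupNamespace false

namespace Summit.NavierStokesRegularity.NavierStokesRegularity.Theorems.TypeITraceScarL3

open MeasureTheory Set Function Filter Topology Metric InnerProductSpace
open Literature.Analysis Literature.Analysis.FluidPDE Literature.Analysis.UnboundedOperators
open scoped NNReal ENNReal RealInnerProductSpace ContDiff

/-- **T27-A «the √2 apex» (ROUND-27), unconditional: `RateSqThreshold` spelled out.** [folklore; Ghidaglia 1986;
Temam IDDS 1997 §III.6; Seregin2014 Prop. 6.20; CaffarelliKohnNirenberg1982 Thm B] -/
theorem two_le_rateSq_of_quietShell :
    ∀ (M D₀ : ℝ≥0) (C : ℝ)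
      (U : ℝ → EuclideanSpace ℝ (Fin 3) → EuclideanSpace ℝ (Fin 3))
      (P : ℝ → EuclideanSpace ℝ (Fin 3) → ℝ)
      (G : ℝ → EuclideanSpace ℝ (Fin 3) →
        EuclideanSpace ℝ (Fin 3) →L[ℝ] EuclideanSpace ℝ (Fin 3)),
      (∀ a : ℝ, 0 < a →
        IsSuitableWeakSolutionInBall a (0 : ℝ × EuclideanSpace ℝ (Fin 3)) U P) →
      (∀ a : ℝ, 0 < a →
        HasWeakSpatialGradientOn
          (parabolicCylinderOpens a (0 : ℝ × EuclideanSpace ℝ (Fin 3))) U G) →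
      (∀ a : ℝ, 0 < a →
        typeIBound (parabolicCylinder a (0 : ℝ × EuclideanSpace ℝ (Fin 3))) U P G ≤ M) →
      (∀ z₀ : ℝ × EuclideanSpace ℝ (Fin 3), z₀.1 ≤ 0 →
        ∀ r : ℝ, 0 < r → cknD r z₀ P ≤ D₀) →
      (∀ s : ℝ, s < 0 →
        ∀ᵐ y : EuclideanSpace ℝ (Fin 3), ‖U s y‖ ≤ C / Real.sqrt (-s)) →
      (∀ φ : EuclideanSpace ℝ (Fin 3) → EuclideanSpace ℝ (Fin 3),
        ContDiff ℝ (⊤ : ℕ∞) φ →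
        HasCompactSupport φ → ∀ ε : ℝ, 0 < ε →
        ∃ s₀ : ℝ, s₀ < 0 ∧ ∀ᵐ s ∂(volume.restrict (Ioo s₀ 0)), |∫ y, ⟪U s y, φ y⟫| ≤ ε) →
      IsBackwardSingularPoint U (0 : ℝ × EuclideanSpace ℝ (Fin 3)) →
      ∀ (A R δ K : ℝ), 1 < A → 0 < R → 0 < δ →
        (∀ᵐ z ∂(volume.restrict
          (Ioo (-δ) 0 ×ˢ {y : EuclideanSpace ℝ (Fin 3) | R < ‖y‖ ∧ ‖y‖ < A * R})),
            ‖U z.1 z.2‖ ≤ K) →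
        2 ≤ C ^ 2 := by
  intro M D₀ C U P G hsw hG hI hD hrate htop hsing A R δ K hA hR hδ hq
  -- ### the classical Oseen-mild representative below the top
  obtain ⟨V, hUV, hVc, hdec, hsm, -, hmild, hwin, -⟩ := exists_classical_repr_of_apexPackage hsw hI hrate
  have hUVs := ae_slice_eq_of_ae_eq_slab hUV
  have hC0 : 0 ≤ C := by
    have h := hdec (-1) (by norm_num) 0
    rw [neg_neg, Real.sqrt_one, div_one] at h
    exact (norm_nonneg _).trans h
  have hAR : R < A * R := by nlinarith
  have hr : 0 < A * R := by positivity
  have h2r : 0 < 2 * (A * R) := by positivity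
  -- ### the shell-budget constants at scale `r = A R`
  obtain ⟨Cb, Fb, hCb, hFb, hbud⟩ := exists_shellBudget_of_mild hr
  have hvolT : volume {z : EuclideanSpace ℝ (Fin 3) | R < ‖z‖ ∧ ‖z‖ < A * R} ≠ ⊤ := by
    refine ne_top_of_le_ne_top (measure_ball_lt_top (μ := volume) (x := (0 : EuclideanSpace ℝ (Fin 3)))
      (r := A * R)).ne (measure_mono fun z hz => ?_)
    rw [mem_ball_zero_iff]; exact hz.2
  -- the uniform bound `B₀`
  obtain ⟨B₀, hB₀def⟩ : ∃ B₀ : ℝ≥0∞, B₀ =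
      Cb * ENNReal.ofReal K ^ 2 * volume {z : EuclideanSpace ℝ (Fin 3) | R < ‖z‖ ∧ ‖z‖ < A * R} +
        (ENNReal.ofReal ((2 * Real.pi * (4 * (A * R - R) / 9) ^ 3)⁻¹) * ENNReal.ofReal (2 * (2 * (A * R)) * M) +
            Fb * ENNReal.ofReal (2 * (A * R) * M)) *
          volume {z : EuclideanSpace ℝ (Fin 3) | R < ‖z‖ ∧ ‖z‖ < A * R} := ⟨_, rfl⟩
  have hB₀ : B₀ ≠ ⊤ := by
    rw [hB₀def]
    refine ENNReal.add_ne_top.2 ⟨ENNReal.mul_ne_top (ENNReal.mul_ne_top hCb (ENNReal.pow_ne_top ENNReal.ofReal_ne_top)) hvolT,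
      ENNReal.mul_ne_top (ENNReal.add_ne_top.2 ⟨ENNReal.mul_ne_top ENNReal.ofReal_ne_top ENNReal.ofReal_ne_top,
        ENNReal.mul_ne_top hFb ENNReal.ofReal_ne_top⟩) hvolT⟩
  -- ### the budget of every window pressure at every late time
  have hPq : ∃ mP δP : ℝ, 0 < δP ∧ ∀ t ∈ Ioo (-δP) 0,
      ∀ (a c : ℝ) (q : ℝ → EuclideanSpace ℝ (Fin 3) → ℝ), t ∈ Ioo a c →
        IsClassicalNSSolutionOn (Ioo a c) 1 0 V q →
        ∃ cst : ℝ, ∫ y in {y : EuclideanSpace ℝ (Fin 3) |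
          (5 * R + 4 * (A * R)) / 9 ≤ ‖y‖ ∧ ‖y‖ ≤ (4 * R + 5 * (A * R)) / 9}, |q t y - cst| ≤ mP := by
    refine ⟨B₀.toReal, min δ ((A * R) ^ 2), lt_min hδ (by positivity), fun t ht a c q htac hcl => ?_⟩
    have htδ : -δ < t := lt_of_le_of_lt (neg_le_neg (min_le_left _ _)) ht.1
    have htr : -(A * R) ^ 2 < t := lt_of_le_of_lt (neg_le_neg (min_le_right _ _)) ht.1
    have ht0 : t < 0 := ht.2
    -- the time window `[t − η, t + η] ⊆ ]a, c[ ∩ ]−∞, 0[`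
    obtain ⟨η, hηdef⟩ : ∃ η : ℝ, η = min (min (t - a) (c - t)) (-t) / 2 := ⟨_, rfl⟩
    have hη : 0 < η := by
      rw [hηdef]; exact half_pos (lt_min (lt_min (by linarith [htac.1]) (by linarith [htac.2])) (by linarith))
    have hη1 : η ≤ (t - a) / 2 := by
      rw [hηdef]; linarith [min_le_left (min (t - a) (c - t)) (-t), min_le_left (t - a) (c - t)]
    have hη2 : η ≤ (c - t) / 2 := by
      rw [hηdef]; linarith [min_le_left (min (t - a) (c - t)) (-t), min_le_right (t - a) (c - t)]
    have hη3 : η ≤ -t / 2 := by rw [hηdef]; linarith [min_le_right (min (t - a) (c - t)) (-t)]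
    have hIcc : Icc (t - η) (t + η) ⊆ Ioo a c := fun s hs => ⟨by linarith [hs.1], by linarith [hs.2]⟩
    have htop' : t + η < 0 := by linarith
    -- the sup bound `M' = C/√(−(t+η))` on the window (rate)
    have hsq : 0 < Real.sqrt (-(t + η)) := Real.sqrt_pos.2 (by linarith)
    have hM'0 : 0 ≤ C / Real.sqrt (-(t + η)) := div_nonneg hC0 hsq.le
    have hM' : ∀ σ ∈ Icc (t - η) (t + η), ∀ y, ‖V σ y‖ ≤ C / Real.sqrt (-(t + η)) := by
      intro σ hσ y
      have hσ0 : σ < 0 := by linarith [hσ.2]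
      refine (hdec σ hσ0 y).trans (div_le_div_of_nonneg_left hC0 hsq ?_)
      exact Real.sqrt_le_sqrt (by linarith [hσ.2])
    -- the Oseen-mild clause on the window
    have hmild' : ∀ s t' : ℝ, s ∈ Icc (t - η) (t + η) → t' ∈ Icc (t - η) (t + η) → s < t' → ∀ x,
        V t' x = heatExtension (V s) (t' - s) x - oseenDuhamel 1 s V V t' x :=
      fun s t' _ ht' hst' x => hmild s t' hst' (by linarith [ht'.2]) x
    -- the A-Morrey bound at time `t` and the quiet bound
    have hα : ∀ z : EuclideanSpace ℝ (Fin 3), ∫⁻ y in ball z (A * R), ‖V t y‖ₑ ^ 2 ≤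
        ENNReal.ofReal (2 * (A * R) * M) := fun z => lintegral_ball_repr_sq_le hI hUVs hsm hr z ⟨htr, ht0⟩
    have hKb : ∀ y : EuclideanSpace ℝ (Fin 3), R < ‖y‖ → ‖y‖ < A * R → ‖V t y‖ ≤ K :=
      norm_repr_le_of_quietShell hq hUV hVc t ⟨htδ, ht0⟩
    -- the budget
    obtain ⟨κ, hκ⟩ := hbud isOpen_Ioo hcl hη hIcc hM'0 hM' hmild' hα (by linarith) hKb
    have hθ : 0 < 4 * (A * R - R) / 9 := by linarith
    have hle := hκ (4 * (A * R - R) / 9) ((5 * R + 4 * (A * R)) / 9) ((4 * R + 5 * (A * R)) / 9) hθ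
      (by linarith) (by linarith) (by linarith)
    -- the `2r`-ball term at time `t`
    have h2ball : ∫⁻ z in ball (0 : EuclideanSpace ℝ (Fin 3)) (2 * (A * R)), ‖V t z‖ₑ ^ 2 ≤
        ENNReal.ofReal (2 * (2 * (A * R)) * M) :=
      lintegral_ball_repr_sq_le hI hUVs hsm h2r 0 ⟨by nlinarith, ht0⟩
    have hleB : ∫⁻ y in {y : EuclideanSpace ℝ (Fin 3) | (5 * R + 4 * (A * R)) / 9 < ‖y‖ ∧
        ‖y‖ < (4 * R + 5 * (A * R)) / 9}, ‖q t y - κ‖ₑ ≤ B₀ := by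
      refine hle.trans ?_
      rw [hB₀def]
      gcongr
    refine ⟨κ, ?_⟩
    have hqm : AEStronglyMeasurable (fun y => q t y - κ) (volume : Measure (EuclideanSpace ℝ (Fin 3))) :=
      ((hcl.contDiff_pressure htac).continuous.sub continuous_const).aestronglyMeasurable
    exact integral_closedAnnulus_le_of_lintegral_annulus_le hqm hB₀ hleB
  -- ### the engine
  exact two_le_rateSq_of_quietShell_of_reprBudget hsw hG hI hD htop hsing hA hR hδ hq hUV hVc hsm
    (fun s hs y => hdec s hs y) hwin hPq

end Summit.NavierStokesRegularity.NavierStokesRegularity.Theorems.TypeITraceScarL3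

end
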